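import Summits.ValiantsHypothesis.ValiantsHypothesis.Theorems.DivisionGapDefs
import Summits.ValiantsHypothesis.ValiantsHypothesis.Theorems.DivisionGapPerDivisionHardPerPowers
import Literature.Computability.AlgebraicComplexity.ValiantClassesProofs

/-!
# Crux `DivisionGap.PerDivisionHard` (stmt-ValiantsHypothesis-5065), line `pair-descent-jss-endpoint` —
stub `stub_insideUniversal`: inside-universality is exponentially expensive (skeleton v9.1, lead seat c5)

A method-counterexample to the line must be RICH on every placed block face `G(b,k) ⊕ M₀` under every
admissible weight (dossier v5 §3, v6 §4).  The cheapest mechanism of richness — monomials supported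
INSIDE the placed face, which are extremal for every admissible weight at once — is unavailable to
cheap cofactors:

* `stub_insideUniversal` — if `h ∈ ℝ≥0[x_ij]` has uniform margins `D ≥ 1` and for EVERY placement
  `eR eC : BlockV b k m ≃ Fin n` some monomial of `h` is supported inside `placedBlock eR eC`, then
  `2^{⌊m/3⌋} ≤ L(h)` (`m ≥ 3` the number of padding vertices; with the line's parameters `m ≥ 3n/4`).

Proof.  Fix a placement `e₀` and vary only the padding bijection: `eC_β = e₀ ∘ (β on padding labels)`.
Padding vertices have degree one in `G(b,k) ⊕ M₀`, so a monomial inside the `β`-placed face meets the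
padding block `P × P` (`P` = padding rows = padding columns of `e₀`) exactly in `D · μ_{β⁻¹}` and has
no mass on the mixed cells `P × Pᶜ ∪ Pᶜ × P`.  Substitute `x_e ↦ X_(t,t')` on `P × P`, `x_e ↦ 1` on
`Pᶜ × Pᶜ`, `x_e ↦ 0` on mixed cells (a projection: `complexity_le_of_isProjection`): the image `h'`
on the `m × m` block has uniform margins `D` and contains all `m!` pure monomials `D · μ_π`, so the
landed typed vertex count `card_pure_mul_two_pow_le` gives `m! · 2^{⌊m/3⌋} ≤ L(h') · m! ≤ L(h) · m!`.
-/

noncomputable section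

-- `Summit.ValiantsHypothesis.ValiantsHypothesis.…` is the tree's mandated single-conjunct layout
-- (Sub = Summit), so the duplicated namespace component is intended.
set_option linter.dupNamespace false

namespace Summit.ValiantsHypothesis.ValiantsHypothesis.Theorems.DivisionGapPerDivisionHard

open MvPolynomial Literature.Computability.AlgebraicComplexity
open Literature.Computability.AlgebraicComplexity.ArithCircuit
open Literature.Barriers.ValiantsHypothesis
open scoped NNReal

variable {b k m n : ℕ}

/-! ### Padding labels and padding-permuted placements -/

/-- The padding label `t` of `G(b,k) ⊕ M₀`. [folklore] -/
def padL (t : Fin m) : BlockV b k m := Sum.inr (Sum.inr t)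

/-- Whether a label is a padding label. [folklore] -/
def isPadB : BlockV b k m → Bool
  | Sum.inr (Sum.inr _) => true
  | _ => false

/-- A label is a padding label iff it is some `padL t`. [folklore] -/
theorem isPadB_eq_true_iff (ℓ : BlockV b k m) : isPadB ℓ = true ↔ ∃ t, ℓ = padL t := by
  rcases ℓ with j | p | t
  · simp [isPadB, padL]
  · simp [isPadB, padL]
  · simp only [isPadB, padL, Sum.inr.injEq, exists_eq']

/-- `padL t` is a padding label. [folklore] -/
@[simp] theorem isPadB_padL (t : Fin m) : isPadB (padL (b := b) (k := k) t) = true := rfl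

/-- Permute the padding labels by `β`, fixing core and internal labels. [folklore] -/
def padPerm (β : Equiv.Perm (Fin m)) : BlockV b k m ≃ BlockV b k m :=
  Equiv.sumCongr (Equiv.refl _) (Equiv.sumCongr (Equiv.refl _) β)

/-- `padPerm β` acts as `β` on padding labels. [folklore] -/
@[simp] theorem padPerm_padL (β : Equiv.Perm (Fin m)) (t : Fin m) :
    padPerm (b := b) (k := k) β (padL t) = padL (β t) := rfl

/-- The inverse of `padPerm β` acts as `β⁻¹` on padding labels. [folklore] -/
@[simp] theorem padPerm_symm_padL (β : Equiv.Perm (Fin m)) (t : Fin m) :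
    (padPerm (b := b) (k := k) β).symm (padL t) = padL (β.symm t) := rfl

/-- A padding row is adjacent only to its own padding column. [folklore] -/
theorem blockAdj_padL_iff (t : Fin m) (ℓ : BlockV b k m) :
    blockAdj b k m (padL t) ℓ = true ↔ ℓ = padL t := by
  rcases ℓ with j | ⟨⟨i, j, s⟩⟩ | t'
  · simp [blockAdj, padL]
  · simp [blockAdj, padL]
  · simp only [blockAdj, padL, decide_eq_true_eq, Sum.inr.injEq]
    exact eq_comm

/-- A padding column is adjacent only to its own padding row. [folklore] -/
theorem blockAdj_padL_right_iff (t : Fin m) (r : BlockV b k m) :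
    blockAdj b k m r (padL t) = true ↔ r = padL t := by
  rcases r with i | ⟨⟨i, j, s⟩⟩ | t'
  · simp [blockAdj, padL]
  · simp [blockAdj, padL]
  · simp only [blockAdj, padL, decide_eq_true_eq, Sum.inr.injEq]

/-! ### The substitution onto the padding block -/

/-- Exponent of the substituted monomial: the padding cell `(t, t')` for the cell
`(e₀ (pad t), e₀ (pad t'))`, nothing otherwise. [folklore] -/
def padExp (e₀ : BlockV b k m ≃ Fin n) (e : Fin n × Fin n) : (Fin m × Fin m) →₀ ℕ :=
  match e₀.symm e.1, e₀.symm e.2 with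
  | Sum.inr (Sum.inr t), Sum.inr (Sum.inr t') => Finsupp.single (t, t') 1
  | _, _ => 0

/-- Coefficient of the substituted monomial: `0` on mixed cells, `1` otherwise. [folklore] -/
def padCoef (e₀ : BlockV b k m ≃ Fin n) (e : Fin n × Fin n) : ℝ≥0 :=
  if isPadB (e₀.symm e.1) = isPadB (e₀.symm e.2) then 1 else 0

/-- The substitution: `X_(t,t')` on padding × padding, `1` on non-padding × non-padding, `0` on
mixed cells. [folklore] -/
def padSubst (e₀ : BlockV b k m ≃ Fin n) (e : Fin n × Fin n) : MvPolynomial (Fin m × Fin m) ℝ≥0 :=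
  monomial (padExp e₀ e) (padCoef e₀ e)

/-- `padExp` of a padding × padding cell. [folklore] -/
theorem padExp_of_pad (e₀ : BlockV b k m ≃ Fin n) (t t' : Fin m) :
    padExp e₀ (e₀ (padL t), e₀ (padL t')) = Finsupp.single (t, t') 1 := by
  simp [padExp, padL]

/-- `padExp e` vanishes unless both labels of `e` are padding labels. [folklore] -/
theorem padExp_eq_zero_of (e₀ : BlockV b k m ≃ Fin n) (e : Fin n × Fin n)
    (h : ¬ (isPadB (e₀.symm e.1) = true ∧ isPadB (e₀.symm e.2) = true)) : padExp e₀ e = 0 := by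
  unfold padExp
  rcases h1 : e₀.symm e.1 with j | p | t <;> rcases h2 : e₀.symm e.2 with j' | p' | t' <;> try rfl
  rw [h1, h2] at h
  exact absurd ⟨rfl, rfl⟩ h

/-- `padExp e` evaluated at a padding cell is the indicator of `e` being that cell. [folklore] -/
theorem padExp_apply (e₀ : BlockV b k m ≃ Fin n) (e : Fin n × Fin n) (t t' : Fin m) :
    padExp e₀ e (t, t') = if e = (e₀ (padL t), e₀ (padL t')) then 1 else 0 := by
  by_cases hp : isPadB (e₀.symm e.1) = true ∧ isPadB (e₀.symm e.2) = true
  · obtain ⟨⟨s, hs⟩, ⟨s', hs'⟩⟩ := (isPadB_eq_true_iff _).mp hp.1, (isPadB_eq_true_iff _).mp hp.2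
    have he : e = (e₀ (padL s), e₀ (padL s')) := by
      ext <;> simp [← hs, ← hs']
    subst he
    rw [padExp_of_pad, Finsupp.single_apply]
    by_cases hst : (s, s') = (t, t')
    · obtain ⟨rfl, rfl⟩ := Prod.mk.inj hst
      simp
    · rw [if_neg hst, if_neg]
      intro h'
      apply hst
      obtain ⟨h1, h2⟩ := Prod.mk.inj h'
      have := e₀.injective h1; have := e₀.injective h2
      simp_all [padL]
  · rw [padExp_eq_zero_of e₀ e hp, Finsupp.coe_zero, Pi.zero_apply]
    split_ifs with he
    · subst he
      simp [padL, isPadB] at hp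
    · rfl

/-- `padCoef` of a padding × padding cell is `1`. [folklore] -/
theorem padCoef_of_pad (e₀ : BlockV b k m ≃ Fin n) (t t' : Fin m) :
    padCoef e₀ (e₀ (padL t), e₀ (padL t')) = 1 := by
  simp [padCoef, padL, isPadB]

/-- `padSubst` is a projection (every variable ↦ a variable or a constant). [folklore] -/
theorem isProjection_padSubst (e₀ : BlockV b k m ≃ Fin n) (p : MvPolynomial (Fin n × Fin n) ℝ≥0) :
    IsProjection (aeval (padSubst e₀) p) p := by
  refine ⟨padSubst e₀, fun e => ?_, rfl⟩
  by_cases hp : isPadB (e₀.symm e.1) = true ∧ isPadB (e₀.symm e.2) = true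
  · obtain ⟨⟨s, hs⟩, ⟨s', hs'⟩⟩ := (isPadB_eq_true_iff _).mp hp.1, (isPadB_eq_true_iff _).mp hp.2
    have he : e = (e₀ (padL s), e₀ (padL s')) := by
      ext <;> simp [← hs, ← hs']
    subst he
    left
    refine ⟨(s, s'), ?_⟩
    rw [padSubst, padExp_of_pad, padCoef_of_pad, X]
  · right
    refine ⟨padCoef e₀ e, ?_⟩
    rw [padSubst, padExp_eq_zero_of e₀ e hp, ← C_apply]

/-! ### The image of a monomial -/

/-- The image of a monomial under `padSubst` (a finite product of monomials is the monomial of the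
summed exponents with the product coefficient — cf. `NewtonUnitEquationsNewtonTauWeak.LeadingTerm.prod_monomial`,
re-derived inline to keep this file's imports inside the route). [folklore] -/
theorem aeval_padSubst_monomial (e₀ : BlockV b k m ≃ Fin n) (d : (Fin n × Fin n) →₀ ℕ) (a : ℝ≥0) :
    aeval (padSubst e₀) (monomial d a) =
      monomial (∑ e ∈ d.support, d e • padExp e₀ e) (a * ∏ e ∈ d.support, padCoef e₀ e ^ d e) := by
  classical
  have hprod : ∀ (s : Finset (Fin n × Fin n)) (f : (Fin n × Fin n) → (Fin m × Fin m) →₀ ℕ)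
      (c : (Fin n × Fin n) → ℝ≥0),
      ∏ i ∈ s, monomial (f i) (c i) = monomial (∑ i ∈ s, f i) (∏ i ∈ s, c i) := by
    intro s f c
    induction s using Finset.induction_on with
    | empty => simp
    | insert x s hx ih => rw [Finset.prod_insert hx, Finset.sum_insert hx, Finset.prod_insert hx,
        ih, monomial_mul]
  rw [aeval_monomial, algebraMap_eq, Finsupp.prod]
  simp only [padSubst, monomial_pow]
  rw [hprod, C_mul_monomial]

/-! ### The stub -/

/-- **`stub_insideUniversal` — inside-universality is exponentially expensive.**  If `h` has uniform
margins `D ≥ 1` and for every placement `eR eC : BlockV b k m ≃ Fin n` some monomial of `h` lies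
inside `placedBlock eR eC`, then `2^{⌊m/3⌋} ≤ L(h)` (`m ≥ 3`; `e₀` any placement, witnessing
`b + b²k + m = n`).  Restrict to padding-permuted copies of `e₀`, substitute onto the `m × m` padding
block (`padSubst`, a projection), and apply the typed vertex count `card_pure_mul_two_pow_le`: the
image has uniform margins `D` and all `m!` pure monomials `D • μ_π`. [folklore] -/
theorem stub_insideUniversal :
    ∀ (b k m n D : ℕ) (e₀ : BlockV b k m ≃ Fin n) (h : MvPolynomial (Fin n × Fin n) ℝ≥0),
      3 ≤ m → 1 ≤ D →
      (∀ α ∈ h.support, (∀ i, ∑ j, α (i, j) = D) ∧ (∀ j, ∑ i, α (i, j) = D)) →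
      (∀ eR eC : BlockV b k m ≃ Fin n, ∃ α ∈ h.support, α.support ⊆ placedBlock eR eC) →
      2 ^ (m / 3) ≤ complexity h := by
  intro b k m n D e₀ h hm hD hmarg huniv
  classical
  -- the projected polynomial and its monomial expansion
  set Φ : ((Fin n × Fin n) →₀ ℕ) → (Fin m × Fin m) →₀ ℕ :=
    fun d => ∑ e ∈ d.support, d e • padExp e₀ e with hΦ
  set κ : ((Fin n × Fin n) →₀ ℕ) → ℝ≥0 := fun d => ∏ e ∈ d.support, padCoef e₀ e ^ d e with hκ
  set h' := aeval (padSubst e₀) h with hh'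
  have hsum : h' = ∑ d ∈ h.support, monomial (Φ d) (coeff d h * κ d) := by
    conv_lhs => rw [hh', h.as_sum]
    rw [map_sum]
    exact Finset.sum_congr rfl fun d _ => aeval_padSubst_monomial e₀ d _
  -- evaluation of `Φ d` at a padding cell
  have hΦapply : ∀ (d : (Fin n × Fin n) →₀ ℕ) (t t' : Fin m),
      Φ d (t, t') = d (e₀ (padL t), e₀ (padL t')) := by
    intro d t t'
    simp only [hΦ, Finsupp.coe_finsetSum, Finset.sum_apply, Finsupp.coe_smul, Pi.smul_apply,
      smul_eq_mul, padExp_apply, mul_ite, mul_one, mul_zero]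
    rw [Finset.sum_ite_eq' d.support (e₀ (padL t), e₀ (padL t')) (fun e => d e)]
    split_ifs with hmem
    · rfl
    · exact (Finsupp.notMem_support_iff.mp hmem).symm
  -- `κ d ≠ 0` means: no mixed cell
  have hκne : ∀ d : (Fin n × Fin n) →₀ ℕ, κ d ≠ 0 → ∀ e ∈ d.support,
      isPadB (e₀.symm e.1) = isPadB (e₀.symm e.2) := by
    intro d hd e he
    by_contra hne
    apply hd
    simp only [hκ]
    exact Finset.prod_eq_zero he (by rw [padCoef, if_neg hne, zero_pow (Finsupp.mem_support_iff.mp he)])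
  -- row / column sums on the padding block of a mixed-free monomial of `h`
  have hrow : ∀ d ∈ h.support, (∀ e ∈ d.support, isPadB (e₀.symm e.1) = isPadB (e₀.symm e.2)) →
      ∀ t : Fin m, ∑ t', d (e₀ (padL t), e₀ (padL t')) = D := by
    intro d hd hmix t
    have h1 := (hmarg d hd).1 (e₀ (padL t))
    rw [← Equiv.sum_comp e₀ (fun j => d (e₀ (padL t), j)), Fintype.sum_sum_type,
      Fintype.sum_sum_type] at h1
    have hz1 : ∑ i : Fin b, d (e₀ (padL t), e₀ (Sum.inl i)) = 0 := by
      refine Finset.sum_eq_zero fun i _ => ?_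
      by_contra hne
      have := hmix _ (Finsupp.mem_support_iff.mpr hne)
      simp [padL, isPadB] at this
    have hz2 : ∑ p : Fin b × Fin b × Fin k, d (e₀ (padL t), e₀ (Sum.inr (Sum.inl p))) = 0 := by
      refine Finset.sum_eq_zero fun p _ => ?_
      by_contra hne
      have := hmix _ (Finsupp.mem_support_iff.mpr hne)
      simp [padL, isPadB] at this
    rw [hz1, hz2, zero_add, zero_add] at h1
    exact h1
  have hcol : ∀ d ∈ h.support, (∀ e ∈ d.support, isPadB (e₀.symm e.1) = isPadB (e₀.symm e.2)) →
      ∀ t' : Fin m, ∑ t, d (e₀ (padL t), e₀ (padL t')) = D := by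
    intro d hd hmix t'
    have h1 := (hmarg d hd).2 (e₀ (padL t'))
    rw [← Equiv.sum_comp e₀ (fun i => d (i, e₀ (padL t'))), Fintype.sum_sum_type,
      Fintype.sum_sum_type] at h1
    have hz1 : ∑ i : Fin b, d (e₀ (Sum.inl i), e₀ (padL t')) = 0 := by
      refine Finset.sum_eq_zero fun i _ => ?_
      by_contra hne
      have := hmix _ (Finsupp.mem_support_iff.mpr hne)
      simp [padL, isPadB] at this
    have hz2 : ∑ p : Fin b × Fin b × Fin k, d (e₀ (Sum.inr (Sum.inl p)), e₀ (padL t')) = 0 := by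
      refine Finset.sum_eq_zero fun p _ => ?_
      by_contra hne
      have := hmix _ (Finsupp.mem_support_iff.mpr hne)
      simp [padL, isPadB] at this
    rw [hz1, hz2, zero_add, zero_add] at h1
    exact h1
  -- margins of the projected polynomial
  have hmarg' : ∀ α ∈ h'.support, (∀ t, ∑ t', α (t, t') = D) ∧ (∀ t', ∑ t, α (t, t') = D) := by
    intro α hα
    rw [hsum] at hα
    obtain ⟨d, hd, hαd⟩ := Finset.mem_biUnion.mp (support_sum hα)
    have hcoef : coeff d h * κ d ≠ 0 := by
      intro h0
      rw [h0, monomial_zero] at hαd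
      simp at hαd
    have hαeq : α = Φ d := Finset.mem_singleton.mp (support_monomial_subset hαd)
    have hmix := hκne d (right_ne_zero_of_mul hcoef)
    subst hαeq
    refine ⟨fun t => ?_, fun t' => ?_⟩
    · simp only [hΦapply]; exact hrow d hd hmix t
    · simp only [hΦapply]; exact hcol d hd hmix t'
  -- every pure monomial `D • μ_π` occurs in the projected polynomial
  have hpure : ∀ π : Equiv.Perm (Fin m), D • permMonomial π ∈ h'.support := by
    intro π
    set eC : BlockV b k m ≃ Fin n := (padPerm π.symm).trans e₀ with heC
    obtain ⟨α, hα, hαG⟩ := huniv e₀ eC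
    -- cells of `α`: adjacency read through the placement
    have hadj : ∀ e ∈ α.support, blockAdj b k m (e₀.symm e.1) (eC.symm e.2) = true := by
      intro e he
      have := hαG he
      simpa [placedBlock] using this
    have heCsymm : ∀ s : Fin m, eC.symm (e₀ (padL s)) = padL (π s) := by
      intro s
      simp [heC]
    -- `α` is mixed-free
    have hmix : ∀ e ∈ α.support, isPadB (e₀.symm e.1) = isPadB (e₀.symm e.2) := by
      intro e he
      have ha := hadj e he
      rw [Bool.eq_iff_iff, isPadB_eq_true_iff, isPadB_eq_true_iff]
      constructor
      · rintro ⟨t, ht⟩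
        rw [ht, blockAdj_padL_iff] at ha
        have : e.2 = eC (padL t) := by rw [← ha, Equiv.apply_symm_apply]
        refine ⟨π.symm t, ?_⟩
        rw [this, heC, Equiv.trans_apply, padPerm_padL, Equiv.symm_apply_apply]
      · rintro ⟨t', ht'⟩
        have he2 : e.2 = e₀ (padL t') := by rw [← ht', Equiv.apply_symm_apply]
        rw [he2, heCsymm, blockAdj_padL_right_iff] at ha
        exact ⟨π t', ha⟩
    -- the padding restriction of `α` is `D • μ_π`
    have hcell : ∀ t t' : Fin m, α (e₀ (padL t), e₀ (padL t')) ≠ 0 → π t' = t := by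
      intro t t' hne
      have ha := hadj _ (Finsupp.mem_support_iff.mpr hne)
      simp only [Equiv.symm_apply_apply] at ha
      rw [heCsymm, blockAdj_padL_iff] at ha
      simpa [padL] using ha
    have hΦα : Φ α = D • permMonomial π := by
      ext ⟨t, t'⟩
      rw [hΦapply, Finsupp.smul_apply, permMonomial_apply, smul_eq_mul, mul_ite, mul_one, mul_zero]
      split_ifs with hπ
      · have hr := hrow α hα hmix t
        rw [Finset.sum_eq_single t' (fun s _ hs => ?_) (by simp)] at hr
        · exact hr
        · by_contra hne
          exact hs (π.injective ((hcell t s hne).trans hπ.symm))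
      · by_contra hne
        exact hπ (hcell t t' hne)
    -- its coefficient in `h'` is at least `coeff α h > 0`
    have hκα : κ α = 1 := by
      simp only [hκ]
      refine Finset.prod_eq_one fun e he => ?_
      rw [padCoef, if_pos (hmix e he), one_pow]
    rw [mem_support_iff, hsum, coeff_sum]
    intro h0
    have hle : coeff (Φ α) (monomial (Φ α) (coeff α h * κ α)) ≤
        ∑ d ∈ h.support, coeff (Φ α) (monomial (Φ d) (coeff d h * κ d)) :=
      Finset.single_le_sum_of_canonicallyOrdered
        (f := fun d => coeff (Φ α) (monomial (Φ d) (coeff d h * κ d))) hα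
    rw [hΦα] at hle
    rw [h0, coeff_monomial, if_pos rfl, hκα, mul_one, nonpos_iff_eq_zero] at hle
    exact (mem_support_iff.mp hα) hle
  -- the typed vertex count on a minimal circuit for `h'`
  obtain ⟨P, h2, hP, hsize⟩ := exists_computes_size_eq_complexity h'
  have heval : P.eval = h' := hP
  have hZ : ∃ Z : Finset ℕ, Z.card ≤ P.size ∧ ∀ j ∉ Z, (gateValues P.gates).getD j 0 = 0 := by
    refine ⟨Finset.range P.size, by simp, fun j hj => getD_gateValues_eq_zero ?_⟩
    exact List.getElem?_eq_none_iff.mpr (by simpa [ArithCircuit.size] using hj)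
  have hcount := card_pure_mul_two_pow_le m D P.size P hm hD h2 hZ (by rw [heval]; exact hmarg')
  have hall : (Finset.univ.filter fun π : Equiv.Perm (Fin m) =>
      D • permMonomial π ∈ P.eval.support) = Finset.univ :=
    Finset.filter_true_of_mem fun π _ => by rw [heval]; exact hpure π
  rw [hall, Finset.card_univ, Fintype.card_perm, Fintype.card_fin, mul_comm, hsize] at hcount
  have hproj : complexity h' ≤ complexity h := complexity_le_of_isProjection (isProjection_padSubst e₀ h)
  exact (Nat.le_of_mul_le_mul_right hcount (Nat.factorial_pos m)).trans hproj

end Summit.ValiantsHypothesis.ValiantsHypothesis.Theorems.DivisionGapPerDivisionHard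

end
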